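import Summits.QuantumFields.YangMills.Theorems.BalabanUVNodesN15KingModelPropagatorLineIntegrability
import Mathlib.Analysis.Complex.CauchyIntegral
import Mathlib.MeasureTheory.Integral.IntegralEqImproper
import Mathlib.Analysis.Fourier.FourierTransform

/-!
# BalabanUVNodes ∕ N15 — THE KING-MODEL RUNG (PART Ϸ-b₂): THE PALEY–WIENER SHIFT FOR THE ONE-LINE BLOCK PROPAGATOR —
# `|∫ sinc²(x∕2)cos(xζ + θ)∕(x² + M²)dx| ≤ 2π(1 + cosh c)∕(c(m² − c²))·e^{−c|ζ|}` for every `0 < c < m`, uniformly in `M² ≥ m²` and in the phase `θ`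
# (Track A, DAG node N15 = NE2; FAN-OUT v1.1 §N15 s3 «KING-MODEL RUNG»; uses part Ϸ-a (`propLine` holomorphy), part Ϸ-b₁ (line integrability, uniform bound, vanishing), and the tree's
# Paley–Wiener bound `Literature.Analysis.Quadrature.norm_fourier_le_exp_mul_integral` (reproduced privately, §0); count-neutral)

HONEST FRAMING.  Count-neutral (cell `pub-ymgap`, seat `pub-ymgap-dag-n15-e` g34; `--supports stmt-QuantumFields-27366 --as helper` = K3⁸
`SpineGivenEndpointR13SepCoPHV`).  King's `A = 0`, `g = 0` model ([King1986] C. King, Commun. Math. Phys. **102** (1986) 649–677): the one-line factor of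
part Ϝ-j's momentum integral for `S₂^{ℝ}` is `x ↦ sinc²(x∕2)∕(x² + M²)`, `M² = m² + |p_⊥|² ≥ m²`.  Its Fourier integral against `cos(xζ + θ)` (the phase `θ = p_⊥·z_⊥`
comes from the other coordinates) decays like `e^{−c|ζ|}` for EVERY `c < m`: the integrand is the restriction of part Ϸ-a's `propLine M²`, holomorphic in the strip
`|Im w| < m` (poles at `±iM`, `M ≥ m`), integrable on the lines `Im w = 0, ±c` with `∫|propLine M²(x ± ic)|dx ≤ 2π(1 + cosh c)∕(c(m² − c²))` UNIFORMLY IN `M² ≥ m²`,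
and uniformly small as `|Re w| → ∞` in the strip — so the tree's Paley–Wiener bound (Trefethen–Weideman's «shift the line of integration») applies.  Part Ϸ-c
integrates this over `p_⊥` to get the optimal clustering rate of `S₂^{ℝ}`.  NOT a node discharge (N15 is booked through n15-a's knit, untouched here); nothing Bałaban ∕
continuum-Yang–Mills ∕ `ℝ⁴` ∕ OS ∕ Clay; the «mass» is the free field's `m`.  0 `sorry`, 0 def; standard axioms.

WHAT THIS FILE PROVES (kernel).  §0 (private, reproduced from the tree) `integral_add_mul_I_eq_integral`, `norm_fourier_le_exp_mul_integral`; §4 ★★ **`norm_fourier_propLine_le`**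
(the Paley–Wiener bound for `𝓕(propLine M²|_ℝ)`, hypotheses from part Ϸ-b₁); §5 `re_cexp_mul_propLine`, ★★★ **`abs_integral_sinc_sq_cos_div_le`** (THE ONE-LINE DECAY BOUND,
every `0 < c`, `c² < m² ≤ M²`, every `ζ, θ`).

HONEST SCOPE.  Elementary complex∕Fourier analysis; folklore; constants not optimised.  N15 untouched; counts unmoved.  Locators (use): [King1986] (4.3) p.670, (4.36)∕(4.38)
pp.674–675, Thm 3.3 (3.6) p.655.
-/

noncomputable section

open scoped BigOperators Topology FourierTransform
open Complex Filter MeasureTheory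

namespace Summit.QuantumFields.YangMills.BalabanUVNodes.N15KingModelRung.OptimalDecay

/-! ## §0 The Paley–Wiener shift (the tree's `Literature.Analysis.Quadrature.norm_fourier_le_exp_mul_integral`, reproduced privately: its module
`TrapezoidalRuleRealLine` imports all of Mathlib and is not built on the farm at this tree)

v1.1 PRIOR-ART NOTE (doc-only; every declaration byte-identical to v1.0).  The tree ALSO holds PUBLIC, BUILT contour-shift ∕ Paley–Wiener lemmas under
`Literature/Analysis/Complex/`: `StripContourShift.integral_eq_integral_add_mul_I_of_strip` and `StripShiftFourierDecay.norm_fourier_le_of_strip`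
(hypotheses: `g` continuous on the CLOSED strip, dominated there by an integrable `B(Re z) → 0`), besides `StripFourierDecay` (Gaussian-damped) and
`DeBruijnStripShift`.  They were not used here because the one-line block propagator's available bound `2(1+cosh Im w)∕(|w|²(Re²w − Im²w + M²))` (part Ϸ-a) is not a
closed-strip majorant near `w = 0`, whereas the line-integrability + uniform-vanishing form below fits it verbatim; a closed-strip majorant (continuity of `sincSqC`
near `0`) would make `norm_fourier_le_of_strip` applicable and this private §0 removable. -/

section PaleyWiener

open Set Asymptotics
open scoped Interval Real

/-- (Verbatim from `Literature/Analysis/Quadrature/TrapezoidalRuleRealLine.lean` — private there too.)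
Shifting the line of integration inside a strip of analyticity: if `g` is holomorphic on the
open strip `|Im z| < a`, tends to zero uniformly as `|Re z| → ∞` there, and is integrable on the two
horizontal lines `Im z = 0` and `Im z = c` (`|c| < a`), then the two line integrals agree
(Cauchy's theorem on the rectangles `[-R, R] × [0, c]`, `R → ∞`; the step "the assumption
`w(x) → 0` in the strip ensures that this shift does not change the value" of the cited proof).
[folklore] -/
private theorem integral_add_mul_I_eq_integral {g : ℂ → ℂ} {a c : ℝ} (hc : |c| < a)
    (hg : DifferentiableOn ℂ g {z : ℂ | |z.im| < a})
    (h0 : Integrable fun x : ℝ => g x) (h1 : Integrable fun x : ℝ => g (x + c * I))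
    (hvan : ∀ ε > 0, ∃ R : ℝ, ∀ z : ℂ, |z.im| < a → R ≤ |z.re| → ‖g z‖ ≤ ε) :
    ∫ x : ℝ, g (x + c * I) = ∫ x : ℝ, g x := by
  -- the rectangle identity for every half-width `R`
  have key : ∀ R : ℝ, (∫ x in -R..R, g x) - (∫ x in -R..R, g (x + c * I)) =
      -(I • ∫ y in (0:ℝ)..c, g (R + y * I)) + I • ∫ y in (0:ℝ)..c, g (-R + y * I) := by
    intro R
    have hd : DifferentiableOn ℂ g ([[((-R : ℝ) : ℂ).re, ((R : ℂ) + c * I).re]] ×ℂ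
        [[((-R : ℝ) : ℂ).im, ((R : ℂ) + c * I).im]]) := by
      refine hg.mono fun z hz => ?_
      rw [mem_reProdIm] at hz
      simp only [ofReal_neg, neg_re, ofReal_re, add_re, mul_re, I_re, mul_zero, ofReal_im,
        I_im, mul_one, sub_self, add_zero, neg_im, neg_zero, add_im, mul_im, zero_add] at hz
      simp only [mem_setOf_eq]
      have h2 : |z.im| ≤ |c| := by
        rcases hz with ⟨-, hz⟩
        rcases le_total 0 c with h | h
        · rw [uIcc_of_le h] at hz; rw [abs_of_nonneg h, abs_le]
          constructor <;> linarith [hz.1, hz.2]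
        · rw [uIcc_of_ge h] at hz; rw [abs_of_nonpos h, abs_le]
          constructor <;> linarith [hz.1, hz.2]
      exact lt_of_le_of_lt h2 hc
    have := Complex.integral_boundary_rect_eq_zero_of_differentiableOn g ((-R : ℝ) : ℂ)
      ((R : ℂ) + c * I) hd
    simp only [ofReal_neg, neg_re, ofReal_re, add_re, mul_re, I_re, mul_zero, ofReal_im,
      I_im, mul_one, sub_self, add_zero, neg_im, neg_zero, add_im, mul_im, zero_add,
      ofReal_zero, zero_mul] at this
    linear_combination this
  -- the left side tends to the difference of the two line integrals
  have hL : Tendsto (fun R : ℝ => (∫ x in -R..R, g x) - ∫ x in -R..R, g (x + c * I)) atTop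
      (𝓝 ((∫ x : ℝ, g x) - ∫ x : ℝ, g (x + c * I))) :=
    (intervalIntegral_tendsto_integral h0 tendsto_neg_atTop_atBot tendsto_id).sub
      (intervalIntegral_tendsto_integral h1 tendsto_neg_atTop_atBot tendsto_id)
  -- each vertical side is small once `R` is large
  have side : ∀ ε > 0, ∃ R₀ : ℝ, ∀ s : ℝ, R₀ ≤ |s| →
      ‖I • ∫ y in (0:ℝ)..c, g (s + y * I)‖ ≤ ε * |c| := by
    intro ε hε
    obtain ⟨R₀, hR₀⟩ := hvan ε hε
    refine ⟨R₀, fun s hs => ?_⟩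
    rw [norm_smul, norm_I, one_mul]
    have := intervalIntegral.norm_integral_le_of_norm_le_const (a := (0:ℝ)) (b := c) (C := ε)
      (f := fun y : ℝ => g (s + y * I)) ?_
    · simpa only [sub_zero] using this
    · intro y hy
      apply hR₀
      · have him : ((s : ℂ) + y * I).im = y := by simp
        rw [him]
        have : |y| ≤ |c| := by
          rcases le_total 0 c with h | h
          · rw [uIoc_of_le h] at hy; rw [abs_of_nonneg h, abs_of_nonneg hy.1.le]; exact hy.2
          · rw [uIoc_of_ge h] at hy; rw [abs_of_nonpos h, abs_of_nonpos hy.2]; linarith [hy.1]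
        exact lt_of_le_of_lt this hc
      · have hre : ((s : ℂ) + y * I).re = s := by simp
        rw [hre]; exact hs
  -- hence the left side tends to zero as well
  have hR : Tendsto (fun R : ℝ => (∫ x in -R..R, g x) - ∫ x in -R..R, g (x + c * I)) atTop
      (𝓝 0) := by
    rw [NormedAddGroup.tendsto_nhds_zero]
    intro ε hε
    obtain ⟨R₀, hR₀⟩ := side (ε / (2 * (|c| + 1))) (by positivity)
    filter_upwards [eventually_ge_atTop (max R₀ 0)] with R hR
    have hR0 : 0 ≤ R := le_trans (le_max_right _ _) hR
    have hR1 : R₀ ≤ R := le_trans (le_max_left _ _) hR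
    rw [key R]
    have e1 := hR₀ R (by rwa [abs_of_nonneg hR0])
    have e2 := hR₀ (-R) (by rwa [abs_neg, abs_of_nonneg hR0])
    push_cast at e2
    calc ‖-(I • ∫ y in (0:ℝ)..c, g (R + y * I)) + I • ∫ y in (0:ℝ)..c, g (-R + y * I)‖
        ≤ ‖I • ∫ y in (0:ℝ)..c, g (R + y * I)‖ + ‖I • ∫ y in (0:ℝ)..c, g (-R + y * I)‖ := by
          refine (norm_add_le _ _).trans ?_; rw [norm_neg]
      _ ≤ ε / (2 * (|c| + 1)) * |c| + ε / (2 * (|c| + 1)) * |c| := add_le_add e1 e2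
      _ = ε * (|c| / (|c| + 1)) := by field_simp; ring
      _ < ε := by
          have : |c| / (|c| + 1) < 1 := by
            rw [div_lt_one (by positivity)]; linarith
          calc ε * (|c| / (|c| + 1)) < ε * 1 := by gcongr
            _ = ε := mul_one ε
  have := tendsto_nhds_unique hL hR
  exact (sub_eq_zero.mp this).symm

/-- (Verbatim from `Literature/Analysis/Quadrature/TrapezoidalRuleRealLine.lean`, whose module is not built on the farm at this tree (`import Mathlib`); kept PRIVATE here.)
Paley–Wiener type decay of the Fourier transform of the restriction to `ℝ` of a function
holomorphic in the strip `|Im z| < a`: shifting the line of integration to `Im z = c` gives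
`‖𝓕 w ξ‖ ≤ e^{2π c ξ} ∫ ‖w (x + ic)‖ dx` (Mathlib's normalisation `𝓕 w ξ = ∫ e^{-2πixξ} w(x) dx`);
with `c = ∓a'` according to the sign of `ξ` and `∫ ‖w(x + ic)‖ ≤ M` this is the bound
`|ŵ(ξ)| ≤ M e^{-2πa'|ξ|}` of the cited proof ("this is the Paley–Wiener result"; eq. (6.11) of the
report version NA-13-15, stated there in the normalisation `ŵ(ξ) = (1/2π) ∫ e^{-iξx} w`).
[cite: TrefethenWeideman2014, proof of Thm. 5.1] -/
private theorem norm_fourier_le_exp_mul_integral {w : ℂ → ℂ} {a c : ℝ} (hc : |c| < a)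
    (hw : DifferentiableOn ℂ w {z : ℂ | |z.im| < a})
    (h0 : Integrable fun x : ℝ => w x) (h1 : Integrable fun x : ℝ => w (x + c * I))
    (hvan : ∀ ε > 0, ∃ R : ℝ, ∀ z : ℂ, |z.im| < a → R ≤ |z.re| → ‖w z‖ ≤ ε) (ξ : ℝ) :
    ‖𝓕 (fun x : ℝ => w x) ξ‖ ≤ Real.exp (2 * π * c * ξ) * ∫ x : ℝ, ‖w (x + c * I)‖ := by
  -- the integrand of the Fourier integral, as a holomorphic function on the strip
  set g : ℂ → ℂ := fun z => cexp (-2 * π * z * ξ * I) * w z with hg_def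
  have hnexp : ∀ z : ℂ, ‖cexp (-2 * π * z * ξ * I)‖ = Real.exp (2 * π * ξ * z.im) := by
    intro z; rw [Complex.norm_exp]; congr 1; simp; ring
  have hF : 𝓕 (fun x : ℝ => w x) ξ = ∫ x : ℝ, g x := by
    rw [Real.fourier_real_eq_integral_exp_smul]
    congr 1; ext x; simp only [hg_def, smul_eq_mul]; push_cast; ring_nf
  have hgd : DifferentiableOn ℂ g {z : ℂ | |z.im| < a} := by
    refine DifferentiableOn.mul ?_ hw
    exact (Complex.differentiable_exp.comp (by fun_prop)).differentiableOn
  -- integrability on the two lines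
  have hint : ∀ (d : ℝ), Integrable (fun x : ℝ => w (x + d * I)) →
      Integrable fun x : ℝ => g (x + d * I) := by
    intro d hd
    refine hd.bdd_mul (c := Real.exp (2 * π * ξ * d)) (by fun_prop) (Eventually.of_forall ?_)
    intro x; rw [hnexp]; simp
  have hg0 : Integrable fun x : ℝ => g x := by simpa using hint 0 (by simpa using h0)
  have hg1 : Integrable fun x : ℝ => g (x + c * I) := hint c h1
  -- uniform vanishing of `g`
  have hgvan : ∀ ε > 0, ∃ R : ℝ, ∀ z : ℂ, |z.im| < a → R ≤ |z.re| → ‖g z‖ ≤ ε := by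
    intro ε hε
    obtain ⟨R, hR⟩ := hvan (ε * Real.exp (-(2 * π * |ξ| * a))) (by positivity)
    refine ⟨R, fun z hz hzR => ?_⟩
    rw [hg_def, norm_mul, hnexp]
    have h1 : Real.exp (2 * π * ξ * z.im) ≤ Real.exp (2 * π * |ξ| * a) := by
      rw [Real.exp_le_exp]
      have : ξ * z.im ≤ |ξ| * a := by
        calc ξ * z.im ≤ |ξ * z.im| := le_abs_self _
          _ = |ξ| * |z.im| := abs_mul _ _
          _ ≤ |ξ| * a := by gcongr
      nlinarith [Real.pi_pos]
    calc Real.exp (2 * π * ξ * z.im) * ‖w z‖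
        ≤ Real.exp (2 * π * |ξ| * a) * (ε * Real.exp (-(2 * π * |ξ| * a))) := by
          gcongr; exact hR z hz hzR
      _ = ε := by rw [Real.exp_neg]; field_simp
  -- shift the line and estimate
  rw [hF, ← integral_add_mul_I_eq_integral hc hgd hg0 hg1 hgvan]
  calc ‖∫ x : ℝ, g (x + c * I)‖ ≤ ∫ x : ℝ, ‖g (x + c * I)‖ := norm_integral_le_integral_norm _
    _ = ∫ x : ℝ, Real.exp (2 * π * c * ξ) * ‖w (x + c * I)‖ := by
        congr 1; ext x; rw [hg_def, norm_mul, hnexp]; simp; left; ring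
    _ = Real.exp (2 * π * c * ξ) * ∫ x : ℝ, ‖w (x + c * I)‖ := integral_const_mul _ _

end PaleyWiener

/-! ## §4 The Paley–Wiener bound for the one-line block propagator -/

section Fourier

variable {m2 M2 c : ℝ}

/-- ★★ **PALEY–WIENER FOR THE ONE-LINE BLOCK PROPAGATOR**: for `c ≠ 0` with `c² < m² ≤ M²` and every frequency `ξ`,
`‖𝓕(propLine M²|_ℝ)(ξ)‖ ≤ e^{2πcξ}·2π(1 + cosh c)∕(|c|(m² − c²))` (shift of the line of integration to `Im w = c`; the tree's `norm_fourier_le_exp_mul_integral`).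
[folklore] -/
theorem norm_fourier_propLine_le (hm : 0 < m2) (hmM : m2 ≤ M2) (hc0 : c ≠ 0) (hc : c ^ 2 < m2) (ξ : ℝ) :
    ‖𝓕 (fun x : ℝ => propLine M2 (x : ℂ)) ξ‖
      ≤ Real.exp (2 * Real.pi * c * ξ) * (2 * Real.pi * (1 + Real.cosh c) / (|c| * (m2 - c ^ 2))) := by
  have hM : 0 < M2 := lt_of_lt_of_le hm hmM
  have hca : |c| < Real.sqrt m2 := by
    rw [← Real.sqrt_sq_eq_abs, Real.sqrt_lt_sqrt_iff (sq_nonneg _)]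
    exact hc
  have ha : Real.sqrt m2 ^ 2 ≤ M2 := by rw [Real.sq_sqrt hm.le]; exact hmM
  have h := norm_fourier_le_exp_mul_integral hca (differentiableOn_propLine hM ha) (integrable_propLine_ofReal hM)
    (integrable_propLine_line hM hmM hc0 hc) (propLine_uniformly_small hmM) ξ
  exact h.trans (mul_le_mul_of_nonneg_left (integral_norm_propLine_line_le hM hmM hc0 hc) (Real.exp_pos _).le)

end Fourier

/-! ## §5 The real one-line decay bound -/

section CosineIntegral

variable {m2 M2 c : ℝ}

/-- The real part of `e^{i(xζ+θ)}·propLine M²(x)` is King's real integrand `sinc²(x∕2)cos(xζ+θ)∕(x² + M²)` (`x ≠ 0`, `M² ≥ 0`). [folklore] -/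
theorem re_cexp_mul_propLine {x : ℝ} (hx : x ≠ 0) (ζ θ : ℝ) :
    (cexp (((x * ζ + θ : ℝ) : ℂ) * I) * propLine M2 (x : ℂ)).re = Real.sinc (x / 2) ^ 2 / (x ^ 2 + M2) * Real.cos (x * ζ + θ) := by
  rw [propLine_ofReal hx, mul_re, ofReal_re, ofReal_im, mul_zero, sub_zero, Complex.exp_ofReal_mul_I_re]
  ring

/-- ★★★ **THE ONE-LINE DECAY BOUND**: for every `0 < c` with `c² < m² ≤ M²` and all `ζ, θ`,
`|∫ sinc²(x∕2)cos(xζ + θ)∕(x² + M²)dx| ≤ 2π(1 + cosh c)∕(c(m² − c²))·e^{−c|ζ|}` — the Fourier integral of the one-line block propagator decays at every rate below the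
distance `M ≥ m` of its poles from the real axis, uniformly in `M² ≥ m²` and in the phase. [folklore] -/
theorem abs_integral_sinc_sq_cos_div_le (hm : 0 < m2) (hmM : m2 ≤ M2) (hc0 : 0 < c) (hc : c ^ 2 < m2) (ζ θ : ℝ) :
    |∫ x : ℝ, Real.sinc (x / 2) ^ 2 / (x ^ 2 + M2) * Real.cos (x * ζ + θ)|
      ≤ 2 * Real.pi * (1 + Real.cosh c) / (c * (m2 - c ^ 2)) * Real.exp (-(c * |ζ|)) := by
  have hM : 0 < M2 := lt_of_lt_of_le hm hmM
  have hπ : Real.pi ≠ 0 := Real.pi_ne_zero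
  set f : ℝ → ℂ := fun x => propLine M2 (x : ℂ) with hf
  -- (A) the complex integral `∫ e^{i(xζ+θ)} f(x) dx` is `e^{iθ}·𝓕 f(−ζ∕2π)`
  have hint : Integrable fun x : ℝ => cexp (((x * ζ + θ : ℝ) : ℂ) * I) * f x := by
    refine (integrable_propLine_ofReal hM).bdd_mul (c := 1) (by fun_prop) (Eventually.of_forall fun x => ?_)
    rw [Complex.norm_exp_ofReal_mul_I]
  have hA : cexp ((θ : ℂ) * I) * 𝓕 f (-ζ / (2 * Real.pi)) = ∫ x : ℝ, cexp (((x * ζ + θ : ℝ) : ℂ) * I) * f x := by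
    rw [Real.fourier_real_eq_integral_exp_smul, ← integral_const_mul]
    refine integral_congr_ae (Eventually.of_forall fun x => ?_)
    simp only [smul_eq_mul]
    have e : ((-2 * Real.pi * x * (-ζ / (2 * Real.pi)) : ℝ) : ℂ) = ((x * ζ : ℝ) : ℂ) := by
      congr 1; field_simp
    rw [e, ← mul_assoc, ← Complex.exp_add]
    congr 2
    push_cast
    ring
  -- (B) its real part is the real integral
  have hB : (∫ x : ℝ, cexp (((x * ζ + θ : ℝ) : ℂ) * I) * f x).re = ∫ x : ℝ, Real.sinc (x / 2) ^ 2 / (x ^ 2 + M2) * Real.cos (x * ζ + θ) := by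
    have h1 := integral_re hint
    simp only [RCLike.re_to_complex] at h1
    rw [← h1]
    refine integral_congr_ae ?_
    filter_upwards [compl_mem_ae_iff.mpr (measure_singleton (0 : ℝ))] with x hx
    exact re_cexp_mul_propLine (M2 := M2) hx ζ θ
  -- (C) hence `|J| ≤ ‖𝓕 f(−ζ∕2π)‖`
  have hC : |∫ x : ℝ, Real.sinc (x / 2) ^ 2 / (x ^ 2 + M2) * Real.cos (x * ζ + θ)| ≤ ‖𝓕 f (-ζ / (2 * Real.pi))‖ := by
    rw [← hB, ← hA]
    refine (Complex.abs_re_le_norm _).trans ?_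
    rw [norm_mul, Complex.norm_exp_ofReal_mul_I, one_mul]
  -- (D) the Paley–Wiener bound with the shift `c' = ±c` according to the sign of `ζ`
  refine hC.trans ?_
  rcases le_or_gt 0 ζ with hζ | hζ
  · have h := norm_fourier_propLine_le hm hmM hc0.ne' hc (-ζ / (2 * Real.pi))
    rw [abs_of_pos hc0] at h
    refine h.trans (le_of_eq ?_)
    rw [abs_of_nonneg hζ, mul_comm]
    congr 1
    congr 1
    field_simp
  · have hc' : (-c) ^ 2 < m2 := by rw [neg_sq]; exact hc
    have h := norm_fourier_propLine_le hm hmM (neg_ne_zero.mpr hc0.ne') hc' (-ζ / (2 * Real.pi))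
    rw [abs_neg, abs_of_pos hc0, Real.cosh_neg, neg_sq] at h
    refine h.trans (le_of_eq ?_)
    rw [abs_of_neg hζ, mul_comm]
    congr 1
    congr 1
    field_simp

end CosineIntegral

end Summit.QuantumFields.YangMills.BalabanUVNodes.N15KingModelRung.OptimalDecay
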